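import Literature.NumberTheory.GaloisRepresentations.LocalBrauerUnramifiedSplitting
import HarnessLib

/-!
# `Br(E)[n] → Br(L)` and `H²(Γ_E, μ_n) → H²(Γ_L, μ_n)` vanish when `n ∣ [L : E]`
# (local fields; Serre, *Corps locaux* XIII §3 Prop. 7)

Topic `NumberTheory/GaloisRepresentations`; namespace `Literature.NumberTheory.GaloisRepresentations`.
Theorems only (no definition, no named fact; D-0026).

Let `F` be a non-archimedean local field of characteristic `0` and `E ⊆ L ⊆ F̄` finite extensions
of `F`, with absolute Galois groups `Γ_E = Gal(F̄/E) ⊇ Γ_L = Gal(F̄/L)` (`galFixing F E`,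
`galFixing F L`), `[L : E] = (Γ_E : Γ_L)` (`(galFixing F L).relIndex (galFixing F E)`).

* `resSub_eq_zero_of_nsmul_eq_zero_of_dvd_relIndex` — **a class `b ∈ Br(E) = H²(Γ_E, F̄ˣ)` with
  `n b = 0` dies in `Br(L)` as soon as `n ∣ [L : E]`** (ANY finite `L ⊇ E`, ramified or not;
  `n = 0` is allowed and vacuous: `[L : E] ≠ 0`).  By local class field theory this is `inv_L ∘ res = [L : E] · inv_E` (Serre XIII §3
  Prop. 7); here it is read off WITHOUT the invariant map from the structure of the relative
  Brauer groups proved in the tree: `Br(E_m/E)`, `E_m = E F_m` the unramified extension of degree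
  `d = [L : E]` (`m = d f_E`), is cyclic of order `d` (`exists_resKer_eq_zmultiples`), it contains
  `b` (`resSub_unrLevel_eq_zero_of_nsmul_eq_zero`: `d b = 0`), and it is generated by the
  unramified class `κ_θ(π_E)` of a uniformiser (order exactly `d`,
  `div_dvd_of_nsmul_cyclicClass_eq_zero`), which DIES in `L` (`resSub_cyclicClass_eq_zero`:
  `π_E = w π_L^{e(L/E)}`, units are norms in unramified extensions, and `e(L/E) κ_ψ(π_L) = 0` for the
  derived character `ψ` of order `e(L/E)`).
* `resSub_two_mu_eq_zero_of_dvd_relIndex` — **every class of `H²(Γ_E, μ_n)` dies on `Γ_L` when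
  `n ∣ [L : E]`** (Kummer: `H²(·, μ_n) ↪ Br` over `L` by Hilbert 90, `kummerTwo_injective`; classes of
  `H²(Γ_E, μ_n)` are killed by `n`).

The case `L = E_{n f_E}` (the unramified extension of degree `n`) is
`LocalBrauerUnramifiedSplitting.lean`; the present file is the general-degree form, the local
input "`Br(K_v)(p) → Br(K'_w)(p)` is zero once `p^∞` divides the local degree" of Serre,
*Cohomologie galoisienne* II §3.3 Prop. 9 / §4.4 Prop. 13 (`cd_p(G_k) ≤ 2` for number fields, the
tree's named fact `fieldCdLE_two_of_numberField`).

## References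

* J.-P. Serre, *Corps locaux*, Hermann, 1968, XIII §3 Prop. 7 and Cor. 1–3. [SerreLocalFields1979]
* J.-P. Serre, *Cohomologie galoisienne* / *Galois Cohomology* (1997), II §3.3 Prop. 9, II §5.2.
  [SerreGaloisCohomology1997]
-/

noncomputable section

open CategoryTheory Function
open Field IsNonarchimedeanLocalField ValuativeRel IntermediateField

universe u

namespace Literature.NumberTheory.GaloisRepresentations

open _root_.TopRep _root_.ContRepresentation _root_.ContinuousCohomology DiscreteGaloisModule
open _root_.Topology _root_.Filter
open LocalWeilDatum

section Local

variable (F : Type u) [Field F] [ValuativeRel F] [TopologicalSpace F] [IsNonarchimedeanLocalField F]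
  [CharZero F]

/-! ### `Br(E)[n]` dies in any `L` with `n ∣ [L : E]` -/

/-- **A class of `Br(E) = H²(Gal(F̄/E), F̄ˣ)` killed by `n` restricts to zero on `Gal(F̄/L)`
for every finite `L ⊇ E` with `n ∣ [L : E]`** (`E`, `L` finite over the non-archimedean local field
`F` of characteristic `0`; `[L : E] = (Gal(F̄/E) : Gal(F̄/L))`).  Serre, *Corps locaux* XIII §3
Prop. 7 (`Br(L/E)` is cyclic of order `[L : E]` inside `Br(E) ≅ ℚ/ℤ`), proved from the tree's
relative-Brauer-group structure theorems without the invariant map: `b ∈ Br(E_{d f_E}/E) = ⟨κ_θ(π_E)⟩`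
(`d = [L : E]`) and `κ_θ(π_E)` dies in `L`.
[cite: SerreLocalFields1979, XIII §3 Prop. 7 and Cor. 1–3] -/
theorem resSub_eq_zero_of_nsmul_eq_zero_of_dvd_relIndex
    (E L : IntermediateField F (AlgebraicClosure F)) [FiniteDimensional F E] [FiniteDimensional F L]
    (hEL : E ≤ L) {n : ℕ} (hnd : n ∣ (galFixing F L).relIndex (galFixing F E))
    (b : continuousCohomology 2 ((units F).restrict (subgroupIncl (galFixing F E))).toTopRep)
    (hb : n • b = 0) :
    resSub (units F) (galFixing_antitone F hEL) 2 b = 0 := by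
  classical
  haveI : IsClosed ((galFixing F E : Subgroup (absoluteGaloisGroup F)) : Set (absoluteGaloisGroup F)) :=
    isClosed_galFixing' F E
  haveI : IsClosed ((galFixing F L : Subgroup (absoluteGaloisGroup F)) : Set (absoluteGaloisGroup F)) :=
    isClosed_galFixing' F L
  haveI : CompactSpace (galFixing F E) := compactSpace_of_isClosed_subgroup
  haveI : CompactSpace (galFixing F L) := compactSpace_of_isClosed_subgroup
  have hLS : galFixing F L ≤ galFixing F E := galFixing_antitone F hEL
  -- a finite Galois `L₀' ⊇ L` (the frame below is `L₁ = L₀' F_m`)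
  obtain ⟨L₀', hfin', hgal', hL₀'⟩ := exists_finiteDimensional_isGalois_galFixing_subset (k := F)
    ((isOpen_galFixing F L).mem_nhds (galFixing F L).one_mem)
  haveI := hfin'
  haveI := hgal'
  have hL₀'L : galFixing F L₀' ≤ galFixing F L := fun σ hσ => hL₀' hσ
  -- the degree `d = [L : E]`
  obtain ⟨d, hddef⟩ : ∃ d : ℕ, d = (galFixing F L).relIndex (galFixing F E) := ⟨_, rfl⟩
  have hd0 : d ≠ 0 := by
    intro h0
    have h1 := Subgroup.relIndex_mul_index hLS
    rw [← hddef, h0, zero_mul] at h1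
    have h3 : (galFixing F L₀').index ≠ 0 := by
      rw [← ker_resGal, Subgroup.index_ker]
      exact Nat.card_pos.ne'
    have h2 : (galFixing F L).index ≠ 0 := fun h0' =>
      h3 (Nat.eq_zero_of_zero_dvd (h0' ▸ Subgroup.index_dvd_of_le hL₀'L))
    exact h2 h1.symm
  have hd : 0 < d := Nat.pos_of_ne_zero hd0
  have hdb : d • b = 0 := by
    obtain ⟨c, hc⟩ := hnd
    rw [← hddef] at hc
    rw [hc, mul_comm, mul_smul, hb, smul_zero]
  -- Step 1: `b` dies on `Gal(F̄/E_m)`, `E_m = E F_m`, `m = d f_E`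
  obtain ⟨m, hmdef⟩ : ∃ m : ℕ, m = d * fDeg F E := ⟨_, rfl⟩
  have hm : 0 < m := hmdef ▸ Nat.mul_pos hd (fDeg_pos F E)
  have h1 : resSub (units F) (galFixing_antitone F (le_unrLevel F E m)) 2 b = 0 := by
    rw [hmdef]
    exact resSub_unrLevel_eq_zero_of_nsmul_eq_zero F E hd b hdb
  haveI := (unramifiedLevel_finite_abelian_unramified F hm).1
  haveI := (unramifiedLevel_finite_abelian_unramified F hm).2.1
  haveI : FiniteDimensional F (unrLevel F E m) := finiteDimensional_unrLevel F E hm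
  -- Step 2: the frame `L₁ = L₀' F_m`
  let L₁ : IntermediateField F (AlgebraicClosure F) := L₀' ⊔ unramifiedLevel F m
  haveI : FiniteDimensional F L₁ := IntermediateField.finiteDimensional_sup L₀' _
  haveI : IsGalois F L₁ := isGalois_iff.2 ⟨inferInstance, inferInstance⟩
  have hLL₁ : L ≤ L₁ := (le_of_galFixing_le F hL₀'L).trans le_sup_left
  have hEL₁ : E ≤ L₁ := hEL.trans hLL₁
  have hmL : unramifiedLevel F m ≤ L₁ := le_sup_right
  let D : Subgroup (L₁ ≃ₐ[F] L₁) := (galFixing F E).map (resGal L₁)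
  let D_L : Subgroup (L₁ ≃ₐ[F] L₁) := (galFixing F L).map (resGal L₁)
  have hDE : layerN L₁ D = galFixing F E := by
    change ((galFixing F E).map (resGal L₁)).comap (resGal L₁) = galFixing F E
    rw [Subgroup.comap_map_eq_self]
    rw [ker_resGal]
    exact galFixing_antitone F hEL₁
  have hDL' : layerN L₁ D_L = galFixing F L := by
    change ((galFixing F L).map (resGal L₁)).comap (resGal L₁) = galFixing F L
    rw [Subgroup.comap_map_eq_self]
    rw [ker_resGal]
    exact galFixing_antitone F hLL₁
  haveI : IsClosed ((layerN L₁ D : Subgroup (absoluteGaloisGroup F)) : Set (absoluteGaloisGroup F)) :=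
    isClosed_layerN L₁ D
  haveI : CompactSpace (layerN L₁ D) := compactSpace_of_isClosed_subgroup
  have hDL : D_L ≤ D := Subgroup.map_mono hLS
  have hfield : fieldOf F L₁ D = E := by
    apply eq_of_galFixing_eq F
    rw [← layerN_eq_galFixing, hDE]
  have hrel : D_L.relIndex D = d := by
    rw [hddef, ← hDE, ← hDL']
    change _ = (D_L.comap (resGal L₁)).relIndex (D.comap (resGal L₁))
    rw [Subgroup.relIndex_comap, Subgroup.map_comap_eq_self_of_surjective (resGal_surjective L₁)]
  -- Step 3: the unramified layer `D_m = D ∩ U_m`: `Br(E_m/E) = ⟨u⟩` of order `d`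
  let D_m : Subgroup (L₁ ≃ₐ[F] L₁) := unrLayer F L₁ D m
  have hDm : D_m ≤ D := unrLayer_le F L₁ D m
  have hnm : (D_m.subgroupOf D).Normal := normal_unrLayer F L₁ D hm
  have hDm' : layerN L₁ D_m = galFixing F (unrLevel F E m) := by
    have h := layerN_unrLayer F L₁ D hmL
    rw [hfield] at h
    exact h
  have hfm : fDeg F (fieldOf F L₁ D) ∣ m := ⟨d, by rw [hfield, hmdef, mul_comm]⟩
  have hdN : m / fDeg F (fieldOf F L₁ D) = d := by
    rw [hfield, hmdef, Nat.mul_div_cancel _ (fDeg_pos F E)]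
  have hrelm : D_m.relIndex D = d := by
    haveI := normal_layerN'_subgroupOf L₁ hDm hnm
    have hcard := natCard_quot_unrLayer F L₁ D hm hmL hfm
    rw [hdN] at hcard
    rw [← Subgroup.map_comap_eq_self_of_surjective (resGal_surjective L₁) D, ← Subgroup.relIndex_comap]
    change (layerS L₁ D D_m).index = d
    rw [Subgroup.index_eq_card]
    exact hcard
  have hmK : m = D_m.relIndex D * fDeg F (fieldOf F L₁ D) := by
    rw [hrelm, hfield, hmdef]
  obtain ⟨u, hker, hordu, -⟩ := exists_resKer_eq_zmultiples F hDm hnm hm hmL hmK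
  rw [hrelm] at hordu
  -- Step 4: the unramified class `κ = κ_θ(π_E)`: in `Br(E_m/E)`, of order `d`, dying in `L`
  haveI : NeZero (m / fDeg F (fieldOf F L₁ D)) := ⟨by rw [hdN]; exact hd0⟩
  obtain ⟨θ, hθ⟩ := exists_unrChar F L₁ hm hmL hfm
  obtain ⟨πK, hπ0, htπ⟩ := exists_tVal_eq_fDeg F (fieldOf F L₁ D) (le_sepClosure_of_charZero F _)
  have hta : tVal F (fieldOf F L₁ D) (kUnit F L₁ D (invOfField F πK hπ0) : fieldOf F L₁ D) =
      fDeg F (fieldOf F L₁ D) := by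
    rw [kUnit_invOfField, Units.val_mk0]
    exact htπ
  set κ := cyclicClass θ (layerRep L₁ D) (invOfField F πK hπ0) with hκdef
  have hmKm : letI := towerAlgebra (fieldOf_mono F L₁ hDm)
      m = Module.finrank (fieldOf F L₁ D) (fieldOf F L₁ D_m) * fDeg F (fieldOf F L₁ D) := by
    rw [finrank_fieldOf_fieldOf F L₁ hDm]
    exact hmK
  have hκm : κ ∈ resKer (units F) (layerN'_le L₁ hDm) :=
    (mem_resKer _ _ _).2 (resSub_cyclicClass_eq_zero F hDm hm hmL hmKm θ hθ _ hta)
  have hmKL : letI := towerAlgebra (fieldOf_mono F L₁ hDL)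
      m = Module.finrank (fieldOf F L₁ D) (fieldOf F L₁ D_L) * fDeg F (fieldOf F L₁ D) := by
    rw [finrank_fieldOf_fieldOf F L₁ hDL, hrel, hfield, hmdef]
  have hκL : resSub (units F) (layerN'_le L₁ hDL) 2 κ = 0 :=
    resSub_cyclicClass_eq_zero F hDL hm hmL hmKL θ hθ _ hta
  have hordκ : addOrderOf κ = d := by
    rw [← hdN]
    refine Nat.dvd_antisymm (addOrderOf_dvd_of_nsmul_eq_zero (nsmul_cyclicClass_eq_zero θ _ _)) ?_
    by_cases h1' : m / fDeg F (fieldOf F L₁ D) = 1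
    · exact (Nat.dvd_one.2 h1').trans (one_dvd _)
    · haveI : Fact (1 < m / fDeg F (fieldOf F L₁ D)) :=
        ⟨lt_of_le_of_ne NeZero.one_le (Ne.symm h1')⟩
      exact div_dvd_of_nsmul_cyclicClass_eq_zero F L₁ hm hmL hfm θ hθ _ hta
        (addOrderOf_nsmul_eq_zero _)
  -- Step 5: transport `b` into the frame: `b' ∈ Br(E_m/E) = ⟨u⟩ ∋ κ`, so `b' ∈ ⟨κ⟩`
  set b' := resSub (units F) hDE.le 2 b with hb'def
  have hb'm : b' ∈ resKer (units F) (layerN'_le L₁ hDm) := by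
    rw [mem_resKer, hb'def, resSub_resSub,
      resSub_eq_zero_congr (units F) hDm' _ (galFixing_antitone F (le_unrLevel F E m))]
    exact h1
  have hdb' : d • b' = 0 := by rw [hb'def, ← map_nsmul, hdb, map_zero]
  rw [hker] at hb'm hκm
  have hb'κ : b' ∈ AddSubgroup.zmultiples κ :=
    mem_zmultiples_of_addOrderOf_eq hordu hκm hordκ hd hb'm hdb'
  -- Step 6: `res_L b' = j • res_L κ = 0`; back to `galFixing F E`
  have hb'L : b' ∈ resKer (units F) (layerN'_le L₁ hDL) := by
    obtain ⟨j, hj⟩ := AddSubgroup.mem_zmultiples_iff.1 hb'κ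
    rw [mem_resKer, ← hj, map_zsmul, hκL, zsmul_zero]
  rw [mem_resKer, hb'def, resSub_resSub, resSub_eq_zero_congr (units F) hDL' _ hLS] at hb'L
  exact hb'L

/-! ### `H²(Γ_E, μ_n)` dies on `Γ_L` when `n ∣ [L : E]` -/

/-- **Every class of `H²(Gal(F̄/E), μ_n)` dies on `Gal(F̄/L)` when `n ∣ [L : E]`** (`n ≥ 1`; `E ⊆ L`
finite over the non-archimedean local field `F` of characteristic `0`): the class is killed by `n`
(`nsmul_two_mu_eq_zero`), its image in `Br(E)` dies in `L`
(`resSub_eq_zero_of_nsmul_eq_zero_of_dvd_relIndex`), and `H²(·, μ_n) → Br` is injective over `L`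
(Kummer, Hilbert 90: `kummerTwo_injective`).  The local input of Serre, *Cohomologie galoisienne*
II §3.3 Prop. 9 (`p`-divisible local degrees kill `Br(·)(p)`).
[cite: SerreLocalFields1979, XIII §3 Prop. 7 and Cor. 3] [cite: SerreGaloisCohomology1997, II §3.3 Prop. 9] -/
theorem resSub_two_mu_eq_zero_of_dvd_relIndex
    (E L : IntermediateField F (AlgebraicClosure F)) [FiniteDimensional F E] [FiniteDimensional F L]
    (hEL : E ≤ L) {n : ℕ} (hn : 0 < n) (hnd : n ∣ (galFixing F L).relIndex (galFixing F E))
    (x : continuousCohomology 2 ((mu F n).restrict (subgroupIncl (galFixing F E))).toTopRep) :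
    resSub (mu F n) (galFixing_antitone F hEL) 2 x = 0 := by
  classical
  haveI : IsClosed ((galFixing F E : Subgroup (absoluteGaloisGroup F)) : Set (absoluteGaloisGroup F)) :=
    isClosed_galFixing' F E
  haveI : IsClosed ((galFixing F L : Subgroup (absoluteGaloisGroup F)) : Set (absoluteGaloisGroup F)) :=
    isClosed_galFixing' F L
  haveI : CompactSpace (galFixing F E) := compactSpace_of_isClosed_subgroup
  haveI : CompactSpace (galFixing F L) := compactSpace_of_isClosed_subgroup
  set h := galFixing_antitone F hEL with hhdef
  -- Kummer injectivity over `L`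
  have hinj := kummerTwo_injective F (galFixing F L) hn (subsingleton_one_units_galFixing L)
  refine (injective_iff_map_eq_zero _).1 hinj _ ?_
  -- naturality of the Kummer map with `res`
  have hnat : kummerTwo F (galFixing F L) n (resSub (mu F n) h 2 x) =
      resSub (units F) h 2 (kummerTwo F (galFixing F E) n x) := by
    obtain ⟨c, rfl⟩ := twoCocycleClass_surjective _ x
    rw [resSub, map_twoCocycleClass, kummerTwo, cohomologyMap_twoCocycleClass, kummerTwo,
      cohomologyMap_twoCocycleClass, resSub, map_twoCocycleClass]
    congr 1
  rw [hnat]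
  exact resSub_eq_zero_of_nsmul_eq_zero_of_dvd_relIndex F E L hEL hnd _
    (by rw [← map_nsmul, nsmul_two_mu_eq_zero, map_zero])

end Local

end Literature.NumberTheory.GaloisRepresentations

end
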